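import Literature.AlgebraicGeometry.Modules.DetClassTensor
import Literature.AlgebraicGeometry.Modules.DetClassDual
import Literature.AlgebraicGeometry.Modules.DetClassOfIso
import Literature.AlgebraicGeometry.Modules.PullbackFrame
import HarnessLib

/-!
# Determinant classes of pulled-back tensor products and duals of line bundles:
# `[f^*(ℳ ⊗ 𝒩^∨)] = [f^*ℳ] · [f^*𝒩]⁻¹` (Hartshorne II Prop. 6.12, Ex. 6.8)

Layer `Literature/AlgebraicGeometry/Modules`, namespace `Literature.AlgebraicGeometry.Modules`.
KERNEL ONLY: theorems; no definition, no named fact, no instance, no `sorry`.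

Class algebra in `Ȟ¹(Y, 𝒪_Y^×)` for rank-one modules `ℳ`, `𝒩` on `X` pulled back along an arbitrary
morphism of schemes `f : Y ⟶ X` — the 2-factor version of the bookkeeping used when a seesaw sheaf
`q₁₂^*ℳ ⊗ (q₁₃^*𝒫)^∨` is restricted to a slice (Mumford, *Abelian Varieties*, §13; cell `hodgecm-mathlib`,
road (R3a), seam (s-iv)).  Everything is on the level of determinant classes (★ `detClass_pullback`,
★ `detClass_tensorObj_of_hasRank_one`, ★ `detClass_dual`; no comparison ISOMORPHISM
`f^*(ℳ ⊗ 𝒩) ≅ f^*ℳ ⊗ f^*𝒩` of modules is used or constructed), and every statement holds for ARBITRARY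
witnesses of local freeness (`detClass_congr` is `rfl`):

* `detClass_pullback_tensorObj` — `[f^*(ℳ ⊗ 𝒩)] = [f^*ℳ] · [f^*𝒩]`;
* `detClass_pullback_dual` — `[f^*(𝒩^∨)] = [f^*𝒩]⁻¹`;
* **`detClass_pullback_tensorObj_dual`** — `[f^*(ℳ ⊗ 𝒩^∨)] = [f^*ℳ] · [f^*𝒩]⁻¹`;
* `detClass_pullback_tensorObj_dual_eq_one_iff` — `[f^*(ℳ ⊗ 𝒩^∨)] = 1 ↔ [f^*ℳ] = [f^*𝒩]`, and
  `nonempty_pullback_iso_iff_detClass_pullback_tensorObj_dual_eq_one` — `f^*ℳ ≅ f^*𝒩 ↔ [f^*(ℳ ⊗ 𝒩^∨)] = 1`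
  (★ `nonempty_iso_iff_detClass_eq`);
* rank bookkeeping `hasRank_pullback_tensorObj_dual`, `isFiniteLocallyFree_pullback_tensorObj_dual`.

## References
* [Hartshorne1977] R. Hartshorne, *Algebraic Geometry* (1977), II Prop. 6.12 (p. 143: `Pic` is a group under
  `⊗`, inverse `𝓛^∨`), II Ex. 6.8 (a) (`f^*` on `Pic` is a homomorphism), III Ex. 4.5 (`Pic X ≅ Ȟ¹(X, 𝒪_X^×)`).
* [MumfordAV1970] D. Mumford, *Abelian Varieties* (1970), §13 (restrictions of `(1 × ψ)^*𝒫` to slices).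
-/

noncomputable section

open CategoryTheory AlgebraicGeometry Opposite TopologicalSpace

universe u

namespace Literature.AlgebraicGeometry.Modules

open Literature.AlgebraicGeometry.Motives

variable {X Y : Scheme.{u}} (f : Y ⟶ X) {M N : X.Modules}

/-- Rank bookkeeping: `f^*(ℳ ⊗ 𝒩^∨)` has rank one for rank-one `ℳ`, `𝒩`. [cite: Hartshorne1977, II Prop. 6.12 (p. 143)] -/
theorem hasRank_pullback_tensorObj_dual (hM : HasRank M 1) (hN : HasRank N 1) :
    HasRank ((Scheme.Modules.pullback f).obj (tensorObj M (Modules.dual N))) 1 :=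
  hasRank_pullback f (hasRank_tensorObj_one hM (hasRank_dual hN))

/-- Rank bookkeeping: `f^*(ℳ ⊗ 𝒩^∨)` is finite locally free for rank-one `ℳ`, `𝒩`.
[cite: Hartshorne1977, II Prop. 6.12 (p. 143)] -/
theorem isFiniteLocallyFree_pullback_tensorObj_dual (hM : HasRank M 1) (hN : HasRank N 1) :
    IsFiniteLocallyFree ((Scheme.Modules.pullback f).obj (tensorObj M (Modules.dual N))) :=
  HasRank.isFiniteLocallyFree' (hasRank_pullback_tensorObj_dual f hM hN)

/-- **`[f^*(ℳ ⊗ 𝒩)] = [f^*ℳ] · [f^*𝒩]`** in `Ȟ¹(Y, 𝒪_Y^×)` for rank-one `ℳ`, `𝒩` and ANY local-freeness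
witnesses (`f^*` is a homomorphism on `Pic`, Hartshorne II Ex. 6.8 (a); ★ `detClass_pullback`,
★ `detClass_tensorObj_of_hasRank_one`). [cite: Hartshorne1977, II Ex. 6.8 (a) and Prop. 6.12 (p. 143)] -/
theorem detClass_pullback_tensorObj (hM : HasRank M 1) (hN : HasRank N 1)
    (h : IsFiniteLocallyFree ((Scheme.Modules.pullback f).obj (tensorObj M N)))
    (hM' : IsFiniteLocallyFree ((Scheme.Modules.pullback f).obj M))
    (hN' : IsFiniteLocallyFree ((Scheme.Modules.pullback f).obj N)) :
    detClass h = detClass hM' * detClass hN' := by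
  have hM₁ := HasRank.isFiniteLocallyFree' hM
  have hN₁ := HasRank.isFiniteLocallyFree' hN
  have hMN := isFiniteLocallyFree_tensorObj _ _ hM₁ hN₁
  rw [detClass_congr h (hMN.pullback f), detClass_pullback (hE := hMN),
    detClass_tensorObj_of_hasRank_one hM hN hM₁ hN₁, map_mul, ← detClass_pullback (hE := hM₁),
    ← detClass_pullback (hE := hN₁)]

/-- **`[f^*(𝒩^∨)] = [f^*𝒩]⁻¹`** in `Ȟ¹(Y, 𝒪_Y^×)` for ANY local-freeness witnesses (★ `detClass_pullback`,
★ `detClass_dual`). [cite: Hartshorne1977, II Ex. 6.8 (a) and Prop. 6.12 (p. 143)] -/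
theorem detClass_pullback_dual (hN₁ : IsFiniteLocallyFree N)
    (h : IsFiniteLocallyFree ((Scheme.Modules.pullback f).obj (Modules.dual N)))
    (hN' : IsFiniteLocallyFree ((Scheme.Modules.pullback f).obj N)) :
    detClass h = (detClass hN')⁻¹ := by
  rw [detClass_congr h ((isFiniteLocallyFree_dual hN₁).pullback f),
    detClass_pullback (hE := isFiniteLocallyFree_dual hN₁), detClass_dual hN₁, map_inv,
    ← detClass_pullback (hE := hN₁)]

/-- **`[f^*(ℳ ⊗ 𝒩^∨)] = [f^*ℳ] · [f^*𝒩]⁻¹`** in `Ȟ¹(Y, 𝒪_Y^×)` for rank-one `ℳ`, `𝒩` on `X`, an arbitrary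
morphism `f : Y ⟶ X` and ANY local-freeness witnesses — the 2-factor class algebra of a seesaw sheaf
restricted to a slice (Mumford §13). [cite: Hartshorne1977, II Ex. 6.8 (a) and Prop. 6.12 (p. 143)]
[cite: MumfordAV1970, §13 (p. 125)] -/
theorem detClass_pullback_tensorObj_dual (hM : HasRank M 1) (hN : HasRank N 1)
    (h : IsFiniteLocallyFree ((Scheme.Modules.pullback f).obj (tensorObj M (Modules.dual N))))
    (hM' : IsFiniteLocallyFree ((Scheme.Modules.pullback f).obj M))
    (hN' : IsFiniteLocallyFree ((Scheme.Modules.pullback f).obj N)) :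
    detClass h = detClass hM' * (detClass hN')⁻¹ := by
  have hN₁ := HasRank.isFiniteLocallyFree' hN
  rw [detClass_pullback_tensorObj f hM (hasRank_dual hN) h hM' ((isFiniteLocallyFree_dual hN₁).pullback f),
    detClass_pullback_dual f hN₁ _ hN']

/-- `[f^*(ℳ ⊗ 𝒩^∨)] = 1 ↔ [f^*ℳ] = [f^*𝒩]` (group algebra in `Ȟ¹(Y, 𝒪_Y^×)`).
[cite: Hartshorne1977, II Prop. 6.12 (p. 143) and III Ex. 4.5] -/
theorem detClass_pullback_tensorObj_dual_eq_one_iff (hM : HasRank M 1) (hN : HasRank N 1)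
    (h : IsFiniteLocallyFree ((Scheme.Modules.pullback f).obj (tensorObj M (Modules.dual N))))
    (hM' : IsFiniteLocallyFree ((Scheme.Modules.pullback f).obj M))
    (hN' : IsFiniteLocallyFree ((Scheme.Modules.pullback f).obj N)) :
    detClass h = 1 ↔ detClass hM' = detClass hN' := by
  rw [detClass_pullback_tensorObj_dual f hM hN h hM' hN', mul_inv_eq_one]

/-- **`f^*ℳ ≅ f^*𝒩 ↔ [f^*(ℳ ⊗ 𝒩^∨)] = 1`** for rank-one `ℳ`, `𝒩` (★ `nonempty_iso_iff_detClass_eq`: rank-one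
modules are classified by their class in `Ȟ¹(Y, 𝒪_Y^×)`). [cite: Hartshorne1977, III Ex. 4.5 and II Prop. 6.12 (p. 143)] -/
theorem nonempty_pullback_iso_iff_detClass_pullback_tensorObj_dual_eq_one (hM : HasRank M 1)
    (hN : HasRank N 1)
    (h : IsFiniteLocallyFree ((Scheme.Modules.pullback f).obj (tensorObj M (Modules.dual N)))) :
    Nonempty ((Scheme.Modules.pullback f).obj M ≅ (Scheme.Modules.pullback f).obj N) ↔ detClass h = 1 := by
  rw [nonempty_iso_iff_detClass_eq (hasRank_pullback f hM) (hasRank_pullback f hN)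
    ((HasRank.isFiniteLocallyFree' hM).pullback f) ((HasRank.isFiniteLocallyFree' hN).pullback f),
    detClass_pullback_tensorObj_dual_eq_one_iff f hM hN h]

end Literature.AlgebraicGeometry.Modules

end
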